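import Literature.NumberTheory.EllipticCurves.Kato2004.LocPKummerLog
import Literature.NumberTheory.EllipticCurves.SelmerUnramified
import Literature.NumberTheory.EllipticCurves.GreenbergSelmer
import Literature.NumberTheory.GaloisRepresentations.DecompositionGroupOfCompletion
import HarnessLib

/-!
# Kato's strict Selmer group `Ker (H¹(O_K[1/P], W[p^∞]) → ⊕_{v ∈ P} H¹(K_v, W[p^∞]))` and the order of
# `H²(ℤ[1/p], T_pW)` read through (14.9.3): the predicate `KatoH2CountAt W p n`

Topic `NumberTheory/EllipticCurves`, sub-directory `Kato2004` (namespace = path).  Seat `bsd-potss-rkm`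
(generation 21, cell `bsd-potss`; crux M = item stmt-BirchSwinnertonDyer-19196 `ReducibleKatoMember` of the
routes K9 / K8-t′), on the planner's re-key request (TARGET R265, T1).  DEFINITIONS ONLY (one subgroup
with a body, one `Prop`-valued predicate with parameters, one unfolding lemma): nothing is asserted, no
named fact is minted, no instance / notation; nothing about BSD is proved.

## The notions (Kato, Astérisque 295, §8.2, §14.1, (14.9.3), (14.14.2), Prop. 14.16)

Kato writes `Hⁱ(O_K[1/p], ·)` for the étale cohomology of `Spec O_K[1/p]` with coefficients `j_*(·)` (§8.2,
p. 181): in degree `1` these are the Galois cohomology classes UNRAMIFIED at every finite place `v ∤ p`.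
His Selmer group `S(K, T ⊗ ℚ/ℤ) ⊆ H¹(O_K[1/p], T ⊗ ℚ/ℤ)` (§14.1) imposes the Bloch–Kato condition above
`p`; the STRICT variant — no classes allowed above `p` — is the kernel
`Ker (H¹(O_K[1/p], T ⊗ ℚ/ℤ) → ⊕_{v ∣ p} H¹(K_v, T ⊗ ℚ/ℤ))`, the group through which the exact
sequence (14.9.3) (Poitou–Tate, p. 240) computes `H²(O_K[1/p], T)`: for `T = T_pW`, `K = ℚ`, `W(ℚ)`
finite and `Ш(W)[p^∞]` finite, local Tate duality at `p` (`H²(ℚ_p, T_pW) ≅ W(ℚ_p)[p^∞]^∨`,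
`H¹(ℚ_p,T)/H¹_f ≅ H¹_f(ℚ_p, W[p^∞])^∨`) and the exactness of (14.9.3) from `H¹(ℚ_p,T)/H¹_f` onwards give

  `#H²(ℤ[1/p], T_pW) · #W(ℚ)[p^∞] = #Sel_str(ℚ, W[p^∞]) · #W(ℚ_p)[p^∞]`,

and (14.14.2) identifies `H²(ℤ[1/p], T_pW)` with the coinvariants `𝐇²/X𝐇²` of Kato's `Λ`-module `𝐇²`.
This file types, in the tree's `SelmerUnramified` / `GreenbergSelmer` currency (classes of
`H¹(Γ_K, W[p^∞]) = galH1Primary W p` principal on the inertia group of the chosen prime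
`adicCompletionPrime K v` above `v`, resp. on the decomposition group `GreenbergSelmer.decomp v`):

* `katoStrictSelmer W p P` — the subgroup of `H¹(K, W[p^∞])` of classes unramified at every finite
  `v ∉ P` and locally trivial at every `v ∈ P` (Kato's strict Selmer group for `P = {v ∣ p}`; over `ℚ`,
  `P = {primePlace p}`; no condition at the infinite places, where `H¹` is `2`-torsion — the intended
  use is `p` odd);
* `KatoH2CountAt W p n` (over `ℚ`) — «`n · #W(ℚ)[p^∞] = #katoStrictSelmer W p {v_p} · #W(ℚ_p)[p^∞]`», i.e.
  "`n` is the order of `H²(ℤ[1/p], T_pW)`" read through (14.9.3); the crux-M package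
  (`MemberHullZetaCoreInputs`) states it for `n = #(𝐇²/X𝐇²)`, which is (14.14.2) + (14.9.3).

The bridge to the cell's `SelmerStructure (primaryGaloisModule W p)` dialect (local condition `⊥` at
`v_p`, `unramifiedSubgroup` at `v ≠ v_p`, `⊤` at `∞`) is the Summits-side
`X11b.LocBridge.localization_inr_eq_zero_iff` (strict) and the `W[p^∞]`-analogue of
`X10.localization_mem_unramifiedSubgroup_iff_mem_unramifiedKer` (unramified); not restated here.

References: K. Kato, Astérisque 295 (2004), §8.2 (p. 181), §14.1 (p. 235), (14.9.3) (p. 240), §14.14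
(14.14.2) (p. 243), Prop. 14.16 and its proof (pp. 244–245) [Kato2004Asterisque]; J. S. Milne, *ADT*
(2006) I Cor. 2.3, Thm. 4.10 [MilneADT2006]; R. Greenberg, LNM 1716 (1999) §2–3 [GreenbergLNM1716];
R. Greenberg, *Iwasawa theory for p-adic representations* (1989) §1 p. 98 [Greenberg1989]; J. H. Silverman,
*AEC* (2009) VIII.§2, X.§4 Lemma 4.3 [SilvermanAEC2009]; tree: `SelmerUnramified.lean` (`unramifiedKer`,
`subgroupResKer`), `GreenbergSelmer.lean` (`decomp`), `GaloisRepresentations/DecompositionGroupOfCompletion.lean`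
(`adicCompletionPrime`), `Selmer.lean` (`galH1Primary`), `Kato2004/LocPKummerLog.lean` (`primePlace`).
-/

noncomputable section

open scoped Classical NumberField
open Field IsDedekindDomain
open Literature.NumberTheory.GaloisRepresentations
open Literature.NumberTheory.EllipticCurves Literature.NumberTheory.EllipticCurves.Kato2004
open WeierstrassCurve (geomPrimaryTorsion galH1Primary)

universe u

namespace Literature.NumberTheory.EllipticCurves.Kato2004

/-! ## §1 Kato's strict Selmer group of `W[p^∞]` -/

section Strict

variable {K : Type u} [Field K] [NumberField K] (W : WeierstrassCurve K) (p : ℕ)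
  (P : Set (HeightOneSpectrum (𝓞 K)))

/-- **Kato's strict Selmer group `Ker (H¹(O_K[1/P], W[p^∞]) → ⊕_{v ∈ P} H¹(K_v, W[p^∞]))`** inside
`H¹(K, W[p^∞]) = galH1Primary W p`: the classes that are UNRAMIFIED at every finite place `v ∉ P`
(principal on the inertia group of the chosen prime `adicCompletionPrime K v` of `\bar ℤ_K` above `v`,
`unramifiedKer`; Kato's `H¹(O_K[1/P], ·)` is étale cohomology with `j_*` coefficients, §8.2) and LOCALLY
TRIVIAL at every `v ∈ P` (principal on the decomposition group `GreenbergSelmer.decomp v` of the chosen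
embedding, `subgroupResKer`; Greenberg's convention of one chosen place above `v`).  For `P = {v ∣ p}`
this is the group through which Kato's Poitou–Tate sequence (14.9.3) computes `H²(O_K[1/p], T_pW)`.
A definition with a body; nothing asserted. [cite: Kato2004Asterisque, §8.2 (p. 181), §14.1 (p. 235) and (14.9.3) (p. 240)]
[cite: Greenberg1989, §1 p. 98] [cite: SilvermanAEC2009, VIII.§2 Definition p. 191 and Lemma X.4.3] -/
def katoStrictSelmer : AddSubgroup (galH1Primary W p) :=
  (⨅ (v : HeightOneSpectrum (𝓞 K)) (_ : v ∈ P),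
      subgroupResKer (geomPrimaryTorsion W p) (GreenbergSelmer.decomp v)) ⊓
    ⨅ (v : HeightOneSpectrum (𝓞 K)) (_ : v ∉ P),
      unramifiedKer (geomPrimaryTorsion W p) (adicCompletionPrime K v)

end Strict

/-! ## §2 The order of `H²(ℤ[1/p], T_pW)` through (14.9.3) -/

section H2Count

variable (W : WeierstrassCurve ℚ) (p : ℕ) [Fact p.Prime]

/-- **`KatoH2CountAt W p n` — "`n` is the order of `H²(ℤ[1/p], T_pW)`", read through Kato's Poitou–Tate
sequence (14.9.3) and local Tate duality at `p`**: `n · #W(ℚ)[p^∞] = #Sel_str(ℚ, W[p^∞]) · #W(ℚ_p)[p^∞]`,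
with `Sel_str = katoStrictSelmer W p {primePlace p}` (unramified off `p`, locally trivial at `p`),
`W(ℚ)[p^∞]` the `p`-primary component of the Mordell–Weil group and `W(ℚ_p)[p^∞]` that of Mathlib's
`(W ⊗ ℚ_v)(ℚ_v)`, `ℚ_v = (primePlace p).adicCompletion ℚ`.  For `W(ℚ)` finite and `Ш(W)[p^∞]` finite this
identity holds for `n = #H²(ℤ[1/p], T_pW)` ((14.9.3) from `H¹(ℚ_p,T)/H¹_f` onwards: the cokernel of
`H¹(ℤ[1/p],T)/H¹_f → H¹(ℚ_p,T)/H¹_f` is dual to `S(T)/Sel_str`, `#H²(ℚ_p,T_pW) = #W(ℚ_p)[p^∞]`,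
`#H⁰(ℚ, W[p^∞]) = #W(ℚ)[p^∞]`); the crux-M package asserts it for `n = #(𝐇²/X𝐇²)` ((14.14.2)).  A `Prop`
with parameters; nothing asserted. [cite: Kato2004Asterisque, (14.9.3) (p. 240), §14.14 (14.14.2) (p. 243) and proof of Prop. 14.16 (p. 245)]
[cite: MilneADT2006, Ch. I, Cor. 2.3 and Thm. 4.10] [cite: GreenbergLNM1716, §2–3] -/
def KatoH2CountAt (n : ℕ) : Prop :=
  n * Nat.card (AddCommGroup.primaryComponent W.toAffine.Point p) =
    Nat.card (katoStrictSelmer W p {primePlace p}) *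
      Nat.card (AddCommGroup.primaryComponent
        (W.baseChange ((primePlace p).adicCompletion ℚ)).toAffine.Point p)

/-- Unfolding `KatoH2CountAt`. [cite: Kato2004Asterisque, (14.9.3) (p. 240) and (14.14.2) (p. 243)] -/
theorem katoH2CountAt_iff (n : ℕ) :
    KatoH2CountAt W p n ↔
      n * Nat.card (AddCommGroup.primaryComponent W.toAffine.Point p) =
        Nat.card (katoStrictSelmer W p {primePlace p}) *
          Nat.card (AddCommGroup.primaryComponent
            (W.baseChange ((primePlace p).adicCompletion ℚ)).toAffine.Point p) :=
  Iff.rfl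

end H2Count

end Literature.NumberTheory.EllipticCurves.Kato2004

end
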